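import Mathlib
import HarnessLib
import Summits.NavierStokesRegularity.NavierStokesRegularity.Theorems.HalfSpaceWindowDoorCirculationCarryingRigidityDefs
import Summits.NavierStokesRegularity.NavierStokesRegularity.Theorems.HalfSpaceWindowDoorCirculationCarryingRigidityReduction
import Summits.NavierStokesRegularity.NavierStokesRegularity.Theorems.HalfSpaceWindowDoorCirculationCarryingRigidityCriticalStretchingAnalytic
import Summits.NavierStokesRegularity.NavierStokesRegularity.Theorems.HalfSpaceWindowDoorCirculationCarryingRigidityWindowedFlux
import Literature.Analysis.UnboundedOperators.HeatKernelBoundedData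
import Literature.Analysis.FluidPDE.AxisymNoSwirlVorticity
import Summits.NavierStokesRegularity.NavierStokesRegularity.Theorems.HalfSpaceWindowDoorCirculationCarryingRigidityPlaneFluxDynamics
import Summits.NavierStokesRegularity.NavierStokesRegularity.Theorems.HalfSpaceWindowDoorCirculationCarryingRigidityTiltingIdentity
import Summits.NavierStokesRegularity.NavierStokesRegularity.Theorems.HalfSpaceWindowDoorCirculationCarryingRigidityTiltingFlux
import Literature.Analysis.UnboundedOperators.HeatKernelHeatEquation
import Literature.Analysis.UnboundedOperators.HeatFlowCalculus
import Literature.Analysis.UnboundedOperators.HeatExtensionHarnack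
import Literature.Analysis.UnboundedOperators.HeatKernelGradient
import Literature.Analysis.UnboundedOperators.HeatKernelReversePoincare
import Literature.Analysis.FluidPDE.AxisymNoSwirlImpulseSlice
import Literature.Analysis.FluidPDE.AxisymHouLiVariables
import Literature.Analysis.Calculus.IicRpowTails
import Literature.Analysis.FluidPDE.ConstantinFeffermanStretching
import Summits.NavierStokesRegularity.NavierStokesRegularity.Theorems.PoloidalWindowDoorPoloidalWindowRigidityScrewKinematics
import Summits.NavierStokesRegularity.NavierStokesRegularity.Theorems.HalfSpaceWindowDoorCirculationCarryingRigidityGaussKernel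
import Summits.NavierStokesRegularity.NavierStokesRegularity.Theorems.HalfSpaceWindowDoorCirculationCarryingRigidityGaussCirculation
import Summits.NavierStokesRegularity.NavierStokesRegularity.Theorems.HalfSpaceWindowDoorCirculationCarryingRigidityGaussStein
import Summits.NavierStokesRegularity.NavierStokesRegularity.Theorems.HalfSpaceWindowDoorCirculationCarryingRigidityGaussTilting
import Summits.NavierStokesRegularity.NavierStokesRegularity.Theorems.HalfSpaceWindowDoorCirculationCarryingRigidityGaussVorticityLaw

/-!
# Route `HalfSpaceWindowDoor`, crux `CirculationCarryingRigidity` (stmt-NavierStokesRegularity-25311) — line «gauss-swirl»,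
# part `GaussSwirlLaw`: the far-past ODE lemma `farPast_eq_zero`, **O1a/O1b PROVED** (`gaussianVorticityLaw_holds`, `gaussianInflowIdentity_holds`),
the slice identity `gaussAngMom_eq_of_class`, **O1 PROVED** (`gaussianSwirlLaw_of_laws`, `gaussianSwirlLaw_holds`:
`d𝒢/ds = −𝒢/(s₀−s) − ℐ/(2(s₀−s))`), the CENSUS THEOREM `poloidal_of_noInflowAxis` and the RUNG **R PROVED OUTRIGHT**
`noInflowStratum_holds` (time-only Type-I class + closed hemisphere + no Gaussian-mean angular-momentum inflow about ONE space–time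
axis before some epoch ⇒ poloidal), the by-name compositions `hemisphereLiouvilleE3_of_rung` (R + K1 ⇒ W6),
`noInflowStratum_of_hemisphereLiouvilleE3` (W6 ⇒ R), `hemisphereLiouvilleE3_of` / `circulationCarryingRigidity_of` (CONDITIONAL on
K1 = `PersistentAxis`, declared wall-strength — these credit nothing)

LINE «gauss-swirl» = ideator ns-idea-4 g11 (D-0145, files-only; critic of record idea-crit-3: PASS, grade new-combination on the wall W6
`…Defs.HemisphereLiouvilleE3`), file of record `pub/ideators/ns-idea-4/lines/gauss-swirl/GaussSwirl_v1_4.lean` (sha16 9f36760ac8cb3b0a,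
`lean check` rc 0, sorries 1 = the research statement K1 only), card `LINE-gauss-swirl_v1_4.md`, PORT-MAP.md 5a0f471fb69fa47f.  PORTED
INTO THE TREE by the LEAD of 25311 (ns-hsw-p1 g6, cell pub-ns-dss) as census support `--supports stmt-NavierStokesRegularity-25311
--as helper`: the proof texts below are the ideator's, VERBATIM modulo the split into ≤ 400-line modules, the `E3 ↦ EuclideanSpace ℝ
(Fin 3)` spelling, the namespace, added one-line docstrings and two `_`-renamings for the unused-variable linter; the vocabulary
(`InDoorClass`, `SignE3`, `gauss`, `angMom`, `gaussAngMom` = 𝒢, `gaussInflow` = ℐ, and the obligation / stratum Props) lives in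
`…CirculationCarryingRigidityDefs`.

THE LINE IN ONE PARAGRAPH.  2D one-signed vorticity has the exact law `d/dt∫|x|²ω = 4νΦ`, which alone kills ancient flows with `Φ > 0`;
in the 3D closed hemisphere (`ω₃ ≥ 0`) it survives for the GAUSSIAN AXIAL ANGULAR MOMENTUM `𝒢(t;x₀) = t^{-3/2}∫e^{−|x−x₀|²/4t} g`
(`= 2t^{-1/2}∫e^{…}ω₃ ≥ 0`), because against the divergence-free Gaussian swirl field `K_t(x−x₀)·e₃×(x−x₀)` pressure AND vortex tilting
drop out exactly, leaving ONE signed residue, the inflow correlation `ℐ = t^{-3/2}∫e^{…}((x−x₀)·v) g`: `d𝒢/ds = −𝒢/(s₀−s) − ℐ/(2(s₀−s))`;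
with the time-only Type-I rate `𝒢/(s₀−s) → 0` in the far past, so «no inflow about ONE space–time axis before some epoch ⇒ poloidal».

WHAT THIS IS NOT: not a statement about Navier–Stokes regularity (Clay A).  The door statements are regularity CRITERIA about
HYPOTHETICAL blow-up profiles (KNSS ancient mild solutions); the research statement K1 `PersistentAxis` (⟺ the wall) is NOT proved,
NOT registered and nothing is closed by this file; item 25311 stays OPEN at its research stub.
-/

noncomputable section

-- the summit and its single sub-problem share the name (CONVENTIONS §1), as in every Theorems file
set_option linter.dupNamespace false

namespace Summit.NavierStokesRegularity.NavierStokesRegularity.Theorems.HalfSpaceWindowDoorCirculationCarryingRigidityGaussSwirlLaw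


open scoped BigOperators Topology MeasureTheory InnerProductSpace RealInnerProductSpace Laplacian ContDiff
open Filter Set Function MeasureTheory Metric
open Literature.Analysis Literature.Analysis.FluidPDE Literature.Analysis.UnboundedOperators
open Summit.NavierStokesRegularity.NavierStokesRegularity.Theses.HalfSpaceWindowDoor
open Summit.NavierStokesRegularity.NavierStokesRegularity.Theorems.HalfSpaceWindowDoorCirculationCarryingRigidityDefs
open Summit.NavierStokesRegularity.NavierStokesRegularity.Theorems.HalfSpaceWindowDoorCirculationCarryingRigidityReduction
  (circulationCarryingRigidity_of_hemisphereLiouvilleE3)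
open Summit.NavierStokesRegularity.NavierStokesRegularity.Theorems.HalfSpaceWindowDoorCirculationCarryingRigidityCriticalStretchingAnalytic
  (inner_curl_e3_eq_zero_of_far_past)
open Summit.NavierStokesRegularity.NavierStokesRegularity.Theorems.LocalSineTubeDoorProfileAlignedWindowRigidityAncient
  (bdd_of_hasTypeITimeDecay analyticOnNhd_slice)
open Summit.NavierStokesRegularity.NavierStokesRegularity.Theorems.PoloidalWindowDoorPoloidalWindowRigidityClassSpaceTimeRates
  (exists_fderiv_rate_of_class' exists_iteratedFDeriv_two_rate_of_class' exists_iteratedFDeriv_three_rate_of_class)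
open Summit.NavierStokesRegularity.NavierStokesRegularity.Theorems.HalfSpaceWindowDoorCirculationCarryingRigidityPlaneFluxDynamics
  (hasDerivAt_inner_curl_e3_convect)
open Summit.NavierStokesRegularity.NavierStokesRegularity.Theorems.HalfSpaceWindowDoorCirculationCarryingRigidityTiltingIdentity
  (convect_sub_stretch_two_eq_divh)
open Summit.NavierStokesRegularity.NavierStokesRegularity.Theorems.HalfSpaceWindowDoorCirculationCarryingRigidityTiltingFlux
  (contDiff_flux norm_flux_le norm_fderiv_flux_le)
open Summit.NavierStokesRegularity.NavierStokesRegularity.Theorems.HalfSpaceWindowDoorCirculationCarryingRigiditySubcriticalStretching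
  (hasDerivAt_inner_curl_e3 fderiv_inner_e3_apply laplacian_inner_e3)
open Summit.NavierStokesRegularity.NavierStokesRegularity.Theorems.HalfSpaceWindowDoorCirculationCarryingRigidityPlaneFluxHeightWindow
  (abs_inner_e3_le contDiff_one_curl)
open Summit.NavierStokesRegularity.NavierStokesRegularity.Theorems.HalfSpaceWindowDoorCirculationCarryingRigidityPlaneLaplacian
  (contDiff_two_curl norm_iteratedFDeriv_two_inner_e3_le)
open Summit.NavierStokesRegularity.NavierStokesRegularity.Theorems.ChiralWindowDoorClassDerivDecay (exists_classical_of_class)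
open Summit.NavierStokesRegularity.NavierStokesRegularity.Theorems.PoloidalWindowDoorPoloidalWindowRigidityScrewKinematics (inner_eq_three)
open Summit.NavierStokesRegularity.NavierStokesRegularity.Theorems.HalfSpaceWindowDoorCirculationCarryingRigidityGaussKernel
open Summit.NavierStokesRegularity.NavierStokesRegularity.Theorems.HalfSpaceWindowDoorCirculationCarryingRigidityGaussCirculation
open Summit.NavierStokesRegularity.NavierStokesRegularity.Theorems.HalfSpaceWindowDoorCirculationCarryingRigidityGaussStein
open Summit.NavierStokesRegularity.NavierStokesRegularity.Theorems.HalfSpaceWindowDoorCirculationCarryingRigidityGaussTilting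
open Summit.NavierStokesRegularity.NavierStokesRegularity.Theorems.HalfSpaceWindowDoorCirculationCarryingRigidityGaussVorticityLaw

/-! ### §2 The far-past ODE engine (PROVED; dictionary row 5) -/

/-- **Far-past ODE lemma.**  If `G ≥ 0` solves `G' = −G/(s₀−s) − I/(2(s₀−s))` on `(−∞, s₁)` (`s₁ ≤ s₀`) with `I ≥ 0` there and
`G` is bounded on some far-past ray, then `G ≡ 0` on `(−∞, s₁)`: the quotient `h = G/(s₀−s)` is non-negative, non-increasing
(`h' = −I/(2(s₀−s)²) ≤ 0`) and tends to `0` at `−∞`. -/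
theorem farPast_eq_zero {G I : ℝ → ℝ} {s₀ s₁ s₂ B : ℝ} (hs₁ : s₁ ≤ s₀)
    (hder : ∀ s < s₁, HasDerivAt G (-(G s) / (s₀ - s) - I s / (2 * (s₀ - s))) s)
    (hG : ∀ s < s₁, 0 ≤ G s) (hI : ∀ s < s₁, 0 ≤ I s) (hB : ∀ s < s₂, |G s| ≤ B) :
    ∀ s < s₁, G s = 0 := by
  -- the quotient `h σ = G σ / (s₀ - σ)` and its derivative
  set h : ℝ → ℝ := fun σ => G σ / (s₀ - σ) with hh
  have hpos : ∀ σ < s₁, 0 < s₀ - σ := fun σ hσ => by linarith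
  have hderiv : ∀ σ < s₁, HasDerivAt h (-(I σ) / (2 * (s₀ - σ) ^ 2)) σ := by
    intro σ hσ
    have hd : HasDerivAt (fun τ : ℝ => s₀ - τ) (-1) σ := by
      simpa using (hasDerivAt_id σ).const_sub s₀
    have hne : (s₀ - σ) ≠ 0 := (hpos σ hσ).ne'
    have hq := (hder σ hσ).div hd hne
    have hval : ((-(G σ) / (s₀ - σ) - I σ / (2 * (s₀ - σ))) * (s₀ - σ) - G σ * -1) / (s₀ - σ) ^ 2
        = -(I σ) / (2 * (s₀ - σ) ^ 2) := by
      field_simp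
      ring
    exact hq.congr_deriv hval
  have hanti : AntitoneOn h (Iio s₁) := by
    have hdiff : ∀ σ ∈ Iio s₁, DifferentiableAt ℝ h σ := fun σ hσ => (hderiv σ hσ).differentiableAt
    refine antitoneOn_of_deriv_nonpos (convex_Iio s₁) ?_ ?_ ?_
    · exact fun σ hσ => (hdiff σ hσ).continuousAt.continuousWithinAt
    · rw [interior_Iio]
      exact fun σ hσ => (hdiff σ hσ).differentiableWithinAt
    · rw [interior_Iio]
      intro σ hσ
      rw [(hderiv σ hσ).deriv]
      have h2 : 0 < 2 * (s₀ - σ) ^ 2 := mul_pos two_pos (pow_pos (hpos σ hσ) 2)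
      exact div_nonpos_of_nonpos_of_nonneg (neg_nonpos.mpr (hI σ hσ)) h2.le
  -- `h ≥ 0`, `h` non-increasing, `h ≤ B/(s₀ - σ)` far back ⇒ `h ≡ 0`
  intro s hs
  have hs0 : 0 < s₀ - s := hpos s hs
  by_contra hne
  have hGpos : 0 < G s := lt_of_le_of_ne (hG s hs) (Ne.symm hne)
  set a : ℝ := G s / (s₀ - s) with ha
  have hapos : 0 < a := div_pos hGpos hs0
  have hBnn : 0 ≤ B := le_trans (abs_nonneg _) (hB (s₂ - 1) (by linarith))
  -- a far-past time σ with σ < s, σ < s₂ and B/(s₀ - σ) < a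
  set σ : ℝ := min (min s s₂) (s₀ - B / a) - 1 with hσdef
  have hσs : σ < s := by
    have : min (min s s₂) (s₀ - B / a) ≤ s := le_trans (min_le_left _ _) (min_le_left _ _)
    linarith
  have hσs₂ : σ < s₂ := by
    have : min (min s s₂) (s₀ - B / a) ≤ s₂ := le_trans (min_le_left _ _) (min_le_right _ _)
    linarith
  have hσB : σ < s₀ - B / a := by
    have : min (min s s₂) (s₀ - B / a) ≤ s₀ - B / a := min_le_right _ _
    linarith
  have hσs₁ : σ < s₁ := lt_trans hσs hs
  have hσ0 : 0 < s₀ - σ := hpos σ hσs₁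
  -- monotonicity: h s ≤ h σ
  have hmono : h s ≤ h σ := hanti (show σ ∈ Iio s₁ from hσs₁) (show s ∈ Iio s₁ from hs) hσs.le
  have hhs : h s = a := rfl
  -- bound: h σ ≤ B / (s₀ - σ) < a
  have hhσ : h σ ≤ B / (s₀ - σ) := by
    change G σ / (s₀ - σ) ≤ B / (s₀ - σ)
    exact div_le_div_of_nonneg_right (le_trans (le_abs_self _) (hB σ hσs₂)) hσ0.le
  have hlt : B / (s₀ - σ) < a := by
    rw [div_lt_iff₀ hσ0]
    have : B / a < s₀ - σ := by linarith
    have h' := (div_lt_iff₀ hapos).mp this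
    linarith [h']
  linarith [hmono, hhσ, hlt, hhs]

/-! ### §2e (v1.2) O1 PROVED: the Gaussian swirl law from the vorticity law (O1a), the inflow identity (O1b) and the slice
identity (O2) -/

/-- **O1a PROVED**: the Gaussian vorticity law holds on the door class. -/
theorem gaussianVorticityLaw_holds : GaussianVorticityLaw := by
  intro C v hv x₀ s₀ s hs hs₀
  obtain ⟨hrate, hcont, hmild, hdiv⟩ := hv
  exact hasDerivAt_gaussVorticity_of_class C v hrate hcont hmild hdiv x₀ s₀ s hs hs₀

/-- **O1b PROVED**: the Gaussian inflow identity holds on the door class. -/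
theorem gaussianInflowIdentity_holds : GaussianInflowIdentity := by
  intro C v hv x₀ t s ht hs
  obtain ⟨hrate, hcont, hmild, hdiv⟩ := hv
  obtain ⟨K₁, -, hK₁⟩ := exists_fderiv_rate_of_class' hrate hcont hmild
  have hA : AnalyticOnNhd ℝ (v s) univ := analyticOnNhd_slice hcont (bdd_of_hasTypeITimeDecay hrate) hmild hs
  have hV1 : ContDiff ℝ 1 (v s) := contDiff_iff_contDiffAt.2 fun x => (hA x (mem_univ x)).contDiffAt
  obtain ⟨-, -, hE⟩ := integral_G_inner_angMom_eq x₀ hV1 (fun x => hrate s hs x) (hK₁ s hs) (hdiv s hs) ht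
  have hgauss : (fun x => gauss t x₀ x * (⟪x - x₀, v s x⟫_ℝ * angMom x₀ (v s) x)) = fun x =>
      (4 * Real.pi * t) ^ ((3 : ℝ) / 2) * (heatKernel t (x - x₀) * (⟪x - x₀, v s x⟫_ℝ * angMom x₀ (v s) x)) := by
    funext x; rw [gauss_eq_heatKernel ht]; ring
  unfold gaussInflow
  rw [hgauss, integral_const_mul, hE, ← rpow_scale ht]; ring

/-- The slice identity in the `⟪·, e₃⟫` form: `𝒢(t;x₀)[v(σ)] = (4π)^{3/2}·2t·∫ G_t(x−x₀) ⟪curl v(σ)(x), e₃⟫ dx`. -/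
theorem gaussAngMom_eq_of_class {C : ℝ} {v : ℝ → (EuclideanSpace ℝ (Fin 3)) → (EuclideanSpace ℝ (Fin 3))} (hv : InDoorClass C v) (x₀ : (EuclideanSpace ℝ (Fin 3))) {t σ : ℝ}
    (ht : 0 < t) (hσ : σ < 0) :
    gaussAngMom t x₀ (v σ) =
      (4 * Real.pi) ^ ((3 : ℝ) / 2) * (2 * t) * ∫ x, heatKernel t (x - x₀) * ⟪curl (v σ) x, e3⟫_ℝ := by
  obtain ⟨hrate, hcont, hmild, -⟩ := hv
  obtain ⟨K₁, -, hK₁⟩ := exists_fderiv_rate_of_class' hrate hcont hmild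
  have hA : AnalyticOnNhd ℝ (v σ) univ := analyticOnNhd_slice hcont (bdd_of_hasTypeITimeDecay hrate) hmild hσ
  have hVd : Differentiable ℝ (v σ) := fun x => (hA x (mem_univ x)).differentiableAt
  have hVc : Continuous (fderiv ℝ (v σ)) := continuousOn_univ.1 hA.fderiv.continuousOn
  have hid := integral_G_angMom_eq hVd hVc (fun x => hrate σ hσ x) (hK₁ σ hσ) ht x₀
  have hgauss : (fun x => gauss t x₀ x * angMom x₀ (v σ) x) = fun x =>
      (4 * Real.pi * t) ^ ((3 : ℝ) / 2) * (heatKernel t (x - x₀) * angMom x₀ (v σ) x) := by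
    funext x; rw [gauss_eq_heatKernel ht]; ring
  unfold gaussAngMom
  rw [hgauss, integral_const_mul, hid, ← rpow_scale ht]
  simp_rw [inner_e3_apply]
  ring

/-- **O1 from O1a + O1b** (`d𝒢/ds = −𝒢/t + (4π)^{3/2}·2t·D₁`, `D₁ = Σⱼ∫∂ⱼG Fⱼ = −(1/2t)∫G(y₀F₀ + y₁F₁)`, `ℐ = (4π)^{3/2}·2t·∫G(y₀F₀+y₁F₁)`). -/
theorem gaussianSwirlLaw_of_laws (hA : GaussianVorticityLaw) (hB : GaussianInflowIdentity) : GaussianSwirlLaw := by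
  intro C v hv x₀ s₀ s hs hs₀
  have ht : 0 < s₀ - s := by linarith
  set c : ℝ := (4 * Real.pi) ^ ((3 : ℝ) / 2) with hc
  have hD := hA C v hv x₀ s₀ s hs hs₀
  have hI := hB C v hv x₀ (s₀ - s) s ht hs
  -- product rule for `σ ↦ c·2(s₀−σ)·N(σ)`
  have hlin : HasDerivAt (fun σ : ℝ => c * (2 * (s₀ - σ))) (c * (2 * (-1))) s := by
    have h1 : HasDerivAt (fun σ : ℝ => s₀ - σ) (-1) s := by simpa using (hasDerivAt_id s).const_sub s₀
    exact (h1.const_mul 2).const_mul c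
  have hprod := hlin.mul hD
  -- the two functions agree near `s`
  have hEq : (fun σ => gaussAngMom (s₀ - σ) x₀ (v σ)) =ᶠ[𝓝 s]
      fun σ => c * (2 * (s₀ - σ)) * ∫ x, heatKernel (s₀ - σ) (x - x₀) * ⟪curl (v σ) x, e3⟫_ℝ := by
    filter_upwards [Iio_mem_nhds hs, Iio_mem_nhds hs₀] with σ hσ hσ₀
    exact gaussAngMom_eq_of_class hv x₀ (sub_pos.2 (mem_Iio.1 hσ₀)) (mem_Iio.1 hσ)
  refine (hprod.congr_of_eventuallyEq hEq).congr_deriv ?_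
  -- the value of the derivative
  obtain ⟨hrate, hcont, hmild, hdiv⟩ := hv
  obtain ⟨K₁, -, hK₁⟩ := exists_fderiv_rate_of_class' hrate hcont hmild
  have hAn : AnalyticOnNhd ℝ (v s) univ := analyticOnNhd_slice hcont (bdd_of_hasTypeITimeDecay hrate) hmild hs
  have hVc : Continuous (v s) := continuousOn_univ.1 hAn.continuousOn
  have hωc : Continuous (curl (v s)) := continuousOn_univ.1 (analyticOnNhd_curl hAn).continuousOn
  have hB : ∀ x, ‖v s x‖ ≤ C / Real.sqrt (-s) := fun x => hrate s hs x
  have hBw : ∀ x, ‖curl (v s) x‖ ≤ 4 * (K₁ / (-s)) := fun x =>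
    (norm_curl_le_four_mul (v s) x).trans (mul_le_mul_of_nonneg_left (hK₁ s hs x) (by norm_num))
  have hFc : ∀ j : Fin 3, Continuous (fun x => v s x j * curl (v s) x 2 - curl (v s) x j * v s x 2) := fun j =>
    ((continuous_apply3 hVc j).mul (continuous_apply3 hωc 2)).sub ((continuous_apply3 hωc j).mul (continuous_apply3 hVc 2))
  have hFb : ∀ (j : Fin 3) x, ‖v s x j * curl (v s) x 2 - curl (v s) x j * v s x 2‖ ≤
      2 * (C / Real.sqrt (-s)) * (4 * (K₁ / (-s))) := by
    intro j x
    rw [Real.norm_eq_abs]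
    have hv' : ∀ i, |v s x i| ≤ C / Real.sqrt (-s) := fun i => (abs_coord_le_norm_e3 _ i).trans (hB x)
    have hw' : ∀ i, |curl (v s) x i| ≤ 4 * (K₁ / (-s)) := fun i => (abs_coord_le_norm_e3 _ i).trans (hBw x)
    have h0 : 0 ≤ C / Real.sqrt (-s) := (abs_nonneg _).trans (hv' 0)
    calc |v s x j * curl (v s) x 2 - curl (v s) x j * v s x 2|
        ≤ |v s x j * curl (v s) x 2| + |curl (v s) x j * v s x 2| := abs_sub _ _
      _ = |v s x j| * |curl (v s) x 2| + |curl (v s) x j| * |v s x 2| := by rw [abs_mul, abs_mul]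
      _ ≤ C / Real.sqrt (-s) * (4 * (K₁ / (-s))) + 4 * (K₁ / (-s)) * (C / Real.sqrt (-s)) :=
          add_le_add (mul_le_mul (hv' j) (hw' 2) (abs_nonneg _) h0)
            (mul_le_mul (hw' j) (hv' 2) (abs_nonneg _) ((abs_nonneg _).trans (hw' 0)))
      _ = 2 * (C / Real.sqrt (-s)) * (4 * (K₁ / (-s))) := by ring
  have J : ∀ j : Fin 3, Integrable (fun x => fderiv ℝ (fun y : (EuclideanSpace ℝ (Fin 3)) => heatKernel (s₀ - s) (y - x₀)) x
      (EuclideanSpace.single j 1) * (v s x j * curl (v s) x 2 - curl (v s) x j * v s x 2)) := fun j =>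
    (integrable_fderiv_G_apply x₀ ht j).mul_bdd (hFc j).aestronglyMeasurable (ae_of_all _ (hFb j))
  have hF : (∫ x, fderiv ℝ (fun y : (EuclideanSpace ℝ (Fin 3)) => heatKernel (s₀ - s) (y - x₀)) x (EuclideanSpace.single 0 1) *
        (v s x 0 * curl (v s) x 2 - curl (v s) x 0 * v s x 2)) +
      (∫ x, fderiv ℝ (fun y : (EuclideanSpace ℝ (Fin 3)) => heatKernel (s₀ - s) (y - x₀)) x (EuclideanSpace.single 1 1) *
        (v s x 1 * curl (v s) x 2 - curl (v s) x 1 * v s x 2)) =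
      -(1 / (2 * (s₀ - s))) * ∫ x, heatKernel (s₀ - s) (x - x₀) *
        ((x - x₀) 0 * (v s x 0 * curl (v s) x 2 - curl (v s) x 0 * v s x 2) +
          (x - x₀) 1 * (v s x 1 * curl (v s) x 2 - curl (v s) x 1 * v s x 2)) := by
    rw [← integral_add (J 0) (J 1), ← integral_const_mul]
    congr 1; funext x
    rw [fderiv_G_apply, fderiv_G_apply]; ring
  rw [gaussAngMom_eq_of_class ⟨hrate, hcont, hmild, hdiv⟩ x₀ ht hs, hI, hF]
  field_simp
  ring

/-- **O1 PROVED (v1.2).** -/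
theorem gaussianSwirlLaw_holds : GaussianSwirlLaw :=
  gaussianSwirlLaw_of_laws gaussianVorticityLaw_holds gaussianInflowIdentity_holds

/-! ### §3 The census theorem (PROVED: O2, O3 in §2b, O1 in §2e) and the compositions BY NAME -/

/-- **Census theorem of the line** (new dead stratum, TIME-ONLY class): a closed-hemisphere door-class profile with NO
Gaussian-mean angular-momentum inflow about ONE space–time axis `(x₀, s₀)` before some epoch `s₁` is poloidal on the whole slab. -/
theorem poloidal_of_noInflowAxis (h1 : GaussianSwirlLaw) (h2 : GaussianCirculation) (h3 : GaussianBound)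
    {C : ℝ} {v : ℝ → (EuclideanSpace ℝ (Fin 3)) → (EuclideanSpace ℝ (Fin 3))} (hv : InDoorClass C v) (hsign : SignE3 v)
    {x₀ : (EuclideanSpace ℝ (Fin 3))} {s₀ s₁ : ℝ} (hs₁ : s₁ < 0) (hs₁₀ : s₁ < s₀)
    (hI : ∀ s < s₁, 0 ≤ gaussInflow (s₀ - s) x₀ (v s)) :
    ∀ s < 0, ∀ y, ⟪curl (v s) y, e3⟫_ℝ = 0 := by
  obtain ⟨B, s₂, -, -, hB⟩ := h3 C v hv x₀ s₀
  have hzero : ∀ s < s₁, gaussAngMom (s₀ - s) x₀ (v s) = 0 :=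
    farPast_eq_zero (G := fun σ => gaussAngMom (s₀ - σ) x₀ (v σ)) (I := fun σ => gaussInflow (s₀ - σ) x₀ (v σ))
      hs₁₀.le (fun s hs => h1 C v hv x₀ s₀ s (lt_trans hs hs₁) (lt_trans hs hs₁₀))
      (fun s hs => (h2 C v hv hsign x₀ (s₀ - s) s (by linarith) (lt_trans hs hs₁)).1)
      hI hB
  have hfar : ∀ τ < s₁, ∀ y, ⟪curl (v τ) y, e3⟫_ℝ = 0 := fun τ hτ =>
    (h2 C v hv hsign x₀ (s₀ - τ) τ (by linarith) (lt_trans hτ hs₁)).2 (hzero τ hτ)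
  exact inner_curl_e3_eq_zero_of_far_past hv.1 hv.2.1 hv.2.2.1 hs₁ hfar

/-- **The rung R from O1–O3** (PROVED). -/
theorem noInflowStratum_of (h1 : GaussianSwirlLaw) (h2 : GaussianCirculation) (h3 : GaussianBound) : NoInflowStratum :=
  fun _ _ hv hsign x₀ _ _ hs₁ hs₁₀ hI => poloidal_of_noInflowAxis h1 h2 h3 hv hsign (x₀ := x₀) hs₁ hs₁₀ hI

/-- **R + K1 ⇒ W6** (PROVED, pure logic): the research statement selects the axis, the rung does the rest. -/
theorem hemisphereLiouvilleE3_of_rung (hR : NoInflowStratum) (hK : PersistentAxis) : HemisphereLiouvilleE3 := by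
  intro C v hrate hcont hmild hdiv hsign
  have hv : InDoorClass C v := ⟨hrate, hcont, hmild, hdiv⟩
  obtain ⟨x₀, s₀, s₁, hs₁, hs₁₀, hI⟩ := hK C v hv hsign
  exact hR C v hv hsign x₀ s₀ s₁ hs₁ hs₁₀ hI

/-- **The wall implies the rung** (R is a CONSEQUENCE of W6 — it sits strictly below it). -/
theorem noInflowStratum_of_hemisphereLiouvilleE3 (h : HemisphereLiouvilleE3) : NoInflowStratum :=
  fun C v hv hsign _ _ _ _ _ _ => h C v hv.1 hv.2.1 hv.2.2.1 hv.2.2.2 hsign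

/-- **W6 BY NAME** modulo the obligations: `HemisphereLiouvilleE3` from O1–O3 and the research statement K1. -/
theorem hemisphereLiouvilleE3_of (h1 : GaussianSwirlLaw) (h2 : GaussianCirculation) (h3 : GaussianBound)
    (hK : PersistentAxis) : HemisphereLiouvilleE3 := by
  intro C v hrate hcont hmild hdiv hsign
  have hv : InDoorClass C v := ⟨hrate, hcont, hmild, hdiv⟩
  obtain ⟨x₀, s₀, s₁, hs₁, hs₁₀, hI⟩ := hK C v hv hsign
  exact poloidal_of_noInflowAxis h1 h2 h3 hv hsign hs₁ hs₁₀ hI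

/-- **The crux BY NAME** modulo the obligations (tree reduction `…Reduction.circulationCarryingRigidity_of_hemisphereLiouvilleE3`,
itself the landed `stub_rotate`). -/
theorem circulationCarryingRigidity_of (h1 : GaussianSwirlLaw) (h2 : GaussianCirculation) (h3 : GaussianBound)
    (hK : PersistentAxis) : CirculationCarryingRigidity :=
  circulationCarryingRigidity_of_hemisphereLiouvilleE3 (hemisphereLiouvilleE3_of h1 h2 h3 hK)

/-- **THE RUNG PROVED OUTRIGHT (v1.2).**  `NoInflowStratum` — closed-hemisphere door-class profiles with no Gaussian-mean
angular-momentum inflow about one space–time axis before some epoch are poloidal — kernel-checked, 0 sorry. -/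
theorem noInflowStratum_holds : NoInflowStratum :=
  noInflowStratum_of gaussianSwirlLaw_holds gaussianCirculation_holds gaussianBound_holds

/-- **W6 ⇐ K1 alone (v1.2).**  The wall decl BY NAME from the single research statement `PersistentAxis`. -/
theorem hemisphereLiouvilleE3_of_persistentAxis (hK : PersistentAxis) : HemisphereLiouvilleE3 :=
  hemisphereLiouvilleE3_of_rung noInflowStratum_holds hK

/-- **Crux ⇐ K1 alone (v1.2).** -/
theorem circulationCarryingRigidity_of_persistentAxis (hK : PersistentAxis) : CirculationCarryingRigidity :=
  circulationCarryingRigidity_of_hemisphereLiouvilleE3 (hemisphereLiouvilleE3_of_persistentAxis hK)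

/-! ### §3b (v1.3) The exact representation «Gaussian circulation = accumulated past inflow» and its strata -/

end Summit.NavierStokesRegularity.NavierStokesRegularity.Theorems.HalfSpaceWindowDoorCirculationCarryingRigidityGaussSwirlLaw

end
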